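import Summits.HubbardSuperconductivity.HubbardSuperconductivity.Theorems.KLProgrammeKLRegimeTwoPointAssemblyMatsubaraDetSplitEntries
import Literature.MathematicalPhysics.QuantumLattice.ChronologicalGramBoundFreeRows
import HarnessLib

/-!
# Route `KLProgramme`, crux K3, child 4 `KLRegimeTwoPointAssembly`, stub `stub_asm_matsubara` —
# part E: the M-UNIFORM POINTWISE BOUND of the Wick determinants (mixed Gram–Hadamard, one single sum per vertex)

Cell gate-hubbard-kl, seat t2 (HOME/t2/MATSUBARA-ALLU-SCOPE.md §2 (b)–(d)).  For `m` points `(x_a, τ_a)` (`τ_a ∈ [0,β]`), a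
`ψ⁺`-leg enumeration `P` and a `ψ⁻`-leg enumeration `Q` (`Fin N → Fin m × Fin 2`, every point carrying at most two legs of
each kind — the interaction vertices carry exactly two, external points one) the finite-frequency Wick matrix
`W_{ij} = −(SᵀC_MS)((P i,+),(Q j,−))` obeys, for EVERY cutoff `M` and EVERY kernel `w ≥ 0` dominating the squared remainder
majorant `δ_M² ≤ w` on `[−β,β]` (part C),

* **`norm_det_vertexWick_le_sum_prod`** — `‖det W‖ ≤ 4^N · 4^m · Σ_{T ⊆ [m]} ∏_{a∈T} Σ_{b∈[m]} w(τ_b − τ_a)`.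

Proof: `W = C~ + R~` with `C~` the tie-broken time-ordered kernel in Pedra–Salmhofer mode form (part D); row multilinearity
`det W = Σ_S det[i∈S ? R~_i : C~_i]`; each mixed determinant is bounded by the tree's augmented chronological Gram bound
`norm_det_timeOrdered_modes_freeRows_le` (unit mode vectors, free rows entering through `ℓ²` row norms);
`Σ_j ‖R~_{ij}‖² ≤ 2 Σ_b w(τ_b − τ_{a_i})` (one single sum per vertex, the two legs of a vertex costing its square root twice);
`Σ_S ∏_{i∈S} = ∏_i (1 + ·)`, fibres `≤ 2`, and `(1+√(2y))² ≤ 4(1+y)`.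
-/

namespace Summit.HubbardSuperconductivity.HubbardSuperconductivity.Theorems.MatsubaraAllU

set_option linter.dupNamespace false -- summit = problem name (single-conjunct summit), D-0017

open Finset Literature.MathematicalPhysics.QuantumLattice Literature.Probability.LatticeModels

noncomputable section

/-- Elementary: `(1 + √(2y))² ≤ 4 (1 + y)` for `y ≥ 0`. -/
theorem one_add_sqrt_two_mul_sq_le {y : ℝ} (hy : 0 ≤ y) : (1 + Real.sqrt (2 * y)) ^ 2 ≤ 4 * (1 + y) := by
  have h2 : Real.sqrt (2 * y) ^ 2 = 2 * y := Real.sq_sqrt (by positivity)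
  nlinarith [Real.sqrt_nonneg (2 * y), sq_nonneg (Real.sqrt (2 * y) - 1)]

/-- `Σ_{T ⊆ [m]} ∏_{a∈T} f a = ∏_a (1 + f a)` over a `Fintype` of subsets. -/
theorem sum_univ_prod_eq_prod_one_add {ι : Type*} [Fintype ι] [DecidableEq ι] (f : ι → ℝ) :
    ∑ T : Finset ι, ∏ a ∈ T, f a = ∏ a, (1 + f a) := by
  rw [Finset.prod_one_add, Finset.powerset_univ]

variable {L : ℕ} [NeZero L]

/-- **M-uniform pointwise bound of the Wick determinant** (mixed Gram–Hadamard with one single sum per vertex).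
For `τ ∈ [0,β]^m`, leg enumerations `P, Q` with fibres `≤ 2`, every cutoff `M` and every `w ≥ 0` with `δ_M(u)² ≤ w(u)` for
`|u| ≤ β`:  `‖det[−(SᵀC_MS)((P i,+),(Q j,−))]‖ ≤ 4^N · 4^m · Σ_{T⊆[m]} ∏_{a∈T} Σ_b w(τ_b − τ_a)`. -/
theorem norm_det_vertexWick_le_sum_prod {M : ℕ} {β : ℝ} (hβ : 0 < β) (μ : ℝ) {m N : ℕ}
    (x : Fin m → TorusSite 2 L) (τ : Fin m → ℝ) (hτ : ∀ a, τ a ∈ Set.Icc (0 : ℝ) β)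
    (P Q : Fin N → Fin m × Fin 2)
    (hP : ∀ a, (univ.filter fun i => (P i).1 = a).card ≤ 2)
    (hQ : ∀ b, (univ.filter fun j => (Q j).1 = b).card ≤ 2)
    (wr : ℝ → ℝ) (hw0 : ∀ u, 0 ≤ wr u)
    (hkey : ∀ u : ℝ, |u| ≤ β →
      ((1 / (L : ℝ) ^ 2) * ∑ q : TorusSite 2 L,
        (‖(1 / (β : ℂ)) * ∑ i : MatsubaraIdx M, Complex.exp (-(Complex.I * matsubaraFreq β M i * u)) *
              (1 / (-(Complex.I * matsubaraFreq β M i) + nambuXi L μ q)) -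
            ((timeOrderedPropagator β (nambuXi L μ q) u : ℝ) : ℂ)‖ + if u = 0 then (1 / 2 : ℝ) else 0)) ^ 2 ≤ wr u) :
    ‖(Matrix.of fun i j : Fin N =>
        -((vertexSubMatrix L M β x τ).transpose * hubbardCovariance L M β μ 0 * vertexSubMatrix L M β x τ)
          ((P i, 0) : VertexLeg m) ((Q j, 1) : VertexLeg m)).det‖ ≤
      (4 : ℝ) ^ N * 4 ^ m * ∑ T : Finset (Fin m), ∏ a ∈ T, ∑ b : Fin m, wr (τ b - τ a) := by
  classical
  -- mode data (Pedra–Salmhofer form) and the split `W = C + R`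
  set d : TorusSite 2 L × Fin 2 → ℝ := fun md => nambuXi L μ md.1 with hd
  set F : Fin N → TorusSite 2 L × Fin 2 → ℂ := fun i md =>
    if md.2 = (P i).2 then ((1 / (L : ℝ) : ℝ) : ℂ) *
      Complex.exp (((∑ j, latticeMomentum L md.1 j * ((x (P i).1 j).val : ℝ) : ℝ) : ℂ) * Complex.I) else 0 with hF
  set G : Fin N → TorusSite 2 L × Fin 2 → ℂ := fun j md =>
    if md.2 = (Q j).2 then ((1 / (L : ℝ) : ℝ) : ℂ) *
      Complex.exp (-(((∑ k, latticeMomentum L md.1 k * ((x (Q j).1 k).val : ℝ) : ℝ) : ℂ) * Complex.I)) else 0 with hG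
  set s : Fin N → ℝ := fun i => τ (P i).1 with hs
  set t : Fin N → ℝ := fun j => τ (Q j).1 with ht
  have hs' : ∀ i, 0 ≤ s i ∧ s i ≤ β := fun i => ⟨(hτ _).1, (hτ _).2⟩
  have ht' : ∀ j, 0 ≤ t j ∧ t j ≤ β := fun j => ⟨(hτ _).1, (hτ _).2⟩
  set W : Matrix (Fin N) (Fin N) ℂ := Matrix.of fun i j : Fin N =>
    -((vertexSubMatrix L M β x τ).transpose * hubbardCovariance L M β μ 0 * vertexSubMatrix L M β x τ)
      ((P i, 0) : VertexLeg m) ((Q j, 1) : VertexLeg m) with hW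
  set C : Matrix (Fin N) (Fin N) ℂ := Matrix.of fun i j : Fin N =>
    if t j ≤ s i then ∑ md, F i md * G j md * ((Real.exp ((s i - t j) * d md) * (1 + Real.exp (β * d md))⁻¹ : ℝ) : ℂ)
    else -∑ md, F i md * G j md * ((Real.exp ((s i - t j) * d md) * (1 + Real.exp (-(β * d md)))⁻¹ : ℝ) : ℂ)
    with hC
  set R : Matrix (Fin N) (Fin N) ℂ := Matrix.of fun i j : Fin N => W i j - C i j with hR
  have hsplit : W = C + R := by
    ext i j
    simp only [hR, Matrix.add_apply, Matrix.of_apply, add_sub_cancel]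
  -- the single sums per vertex and the remainder rows
  set ρ2 : Fin m → ℝ := fun a => ∑ b : Fin m, wr (τ b - τ a) with hρ2
  have hρ2 : ∀ a, 0 ≤ ρ2 a := fun a => Finset.sum_nonneg fun b _ => hw0 _
  have hRij : ∀ i j, ‖R i j‖ ^ 2 ≤ if (P i).2 = (Q j).2 then wr (τ (Q j).1 - τ (P i).1) else 0 := by
    intro i j
    have h1 := norm_wickEntry_sub_tieKernel_le (M := M) hβ.ne' μ x τ (P i).1 (Q j).1 (P i).2 (Q j).2
    have h1' : ‖R i j‖ ≤ if (P i).2 = (Q j).2 then (1 / (L : ℝ) ^ 2) * ∑ q : TorusSite 2 L,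
        (‖(1 / (β : ℂ)) * ∑ i' : MatsubaraIdx M,
              Complex.exp (-(Complex.I * matsubaraFreq β M i' * ((τ (Q j).1 - τ (P i).1 : ℝ) : ℂ))) *
                (1 / (-(Complex.I * matsubaraFreq β M i') + nambuXi L μ q)) -
            ((timeOrderedPropagator β (nambuXi L μ q) (τ (Q j).1 - τ (P i).1) : ℝ) : ℂ)‖ +
          if τ (Q j).1 - τ (P i).1 = 0 then (1 / 2 : ℝ) else 0) else 0 := by
      simpa only [hR, hW, hC, hF, hG, hs, ht, hd, Matrix.of_apply] using h1
    have habs : |τ (Q j).1 - τ (P i).1| ≤ β := by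
      rw [abs_le]
      constructor <;> linarith [(hτ (Q j).1).1, (hτ (Q j).1).2, (hτ (P i).1).1, (hτ (P i).1).2]
    split_ifs with hσ
    · rw [if_pos hσ] at h1'
      refine le_trans ?_ (hkey _ habs)
      exact pow_le_pow_left₀ (norm_nonneg _) h1' 2
    · rw [if_neg hσ] at h1'
      have : ‖R i j‖ = 0 := le_antisymm h1' (norm_nonneg _)
      rw [this]; norm_num
  have hrow : ∀ i, ∑ j, ‖R i j‖ ^ 2 ≤ 2 * ρ2 (P i).1 := by
    intro i
    calc ∑ j, ‖R i j‖ ^ 2 ≤ ∑ j, wr (τ (Q j).1 - τ (P i).1) := Finset.sum_le_sum fun j _ =>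
            (hRij i j).trans (by split_ifs <;> simp [hw0])
      _ ≤ 2 * ∑ b : Fin m, wr (τ b - τ (P i).1) :=
          sum_comp_le_two_mul_sum (fun j => (Q j).1) hQ (fun b => wr (τ b - τ (P i).1)) fun b => hw0 _
  -- norms of the mode vectors
  have hFn : ∀ i, ∑ md, ‖F i md‖ ^ 2 = 1 := fun i => sum_norm_sq_legF (x (P i).1) (P i).2
  have hGn : ∀ j, ∑ md, ‖G j md‖ ^ 2 = 1 := fun j => sum_norm_sq_legG (x (Q j).1) (Q j).2
  -- the mixed determinants
  have hmixed : ∀ S : Finset (Fin N),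
      ‖(Matrix.of fun i j => if i ∈ S then R i j else C i j).det‖ ≤
        (4 : ℝ) ^ N * ∏ i ∈ S, Real.sqrt (2 * ρ2 (P i).1) := by
    intro S
    have key := norm_det_timeOrdered_modes_freeRows_le d β F G s t hs' ht' S (fun i j => R i j)
    have hmat : (Matrix.of fun i j => if i ∈ S then R i j else C i j) =
        Matrix.of fun a b : Fin N => if a ∈ S then R a b else
          if t b ≤ s a then ∑ md, F a md * G b md *
              ((Real.exp ((s a - t b) * d md) * (1 + Real.exp (β * d md))⁻¹ : ℝ) : ℂ)
          else -∑ md, F a md * G b md *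
              ((Real.exp ((s a - t b) * d md) * (1 + Real.exp (-(β * d md)))⁻¹ : ℝ) : ℂ) := by
      ext a b
      simp only [Matrix.of_apply, hC]
    rw [hmat]
    refine key.trans ?_
    simp_rw [hFn, hGn, Real.sqrt_one]
    have hcol : ∏ _b : Fin N, Real.sqrt (1 + 1) ≤ (2 : ℝ) ^ N := by
      rw [Finset.prod_const, Finset.card_univ, Fintype.card_fin]
      refine pow_le_pow_left₀ (Real.sqrt_nonneg _) ?_ N
      nlinarith [Real.sq_sqrt (show (0 : ℝ) ≤ 1 + 1 by norm_num), Real.sqrt_nonneg (1 + 1)]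
    have hrows : (∏ a, if a ∈ S then Real.sqrt (∑ b, ‖R a b‖ ^ 2) else 1) ≤
        ∏ i ∈ S, Real.sqrt (2 * ρ2 (P i).1) := by
      rw [← Finset.prod_filter, Finset.filter_mem_eq_inter, Finset.univ_inter]
      exact Finset.prod_le_prod (fun i _ => Real.sqrt_nonneg _) fun i _ => Real.sqrt_le_sqrt (hrow i)
    have h0 : 0 ≤ ∏ a, (if a ∈ S then Real.sqrt (∑ b, ‖R a b‖ ^ 2) else 1) :=
      Finset.prod_nonneg fun a _ => by split_ifs <;> [exact Real.sqrt_nonneg _; norm_num]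
    calc (2 : ℝ) ^ N * ((∏ a, if a ∈ S then Real.sqrt (∑ b, ‖R a b‖ ^ 2) else 1) *
          ∏ _b : Fin N, Real.sqrt (1 + 1))
        ≤ 2 ^ N * ((∏ i ∈ S, Real.sqrt (2 * ρ2 (P i).1)) * 2 ^ N) := by
          gcongr
      _ = 4 ^ N * ∏ i ∈ S, Real.sqrt (2 * ρ2 (P i).1) := by
          rw [show (4 : ℝ) ^ N = 2 ^ N * 2 ^ N by rw [← mul_pow]; norm_num]
          ring
  -- sum over the row subsets
  have hdet : ‖W.det‖ ≤ (4 : ℝ) ^ N * ∏ i : Fin N, (1 + Real.sqrt (2 * ρ2 (P i).1)) := by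
    rw [hsplit, det_add_eq_sum_det_piecewise]
    refine (norm_sum_le _ _).trans ?_
    calc ∑ S : Finset (Fin N), ‖(Matrix.of fun i j => if i ∈ S then R i j else C i j).det‖
        ≤ ∑ S : Finset (Fin N), (4 : ℝ) ^ N * ∏ i ∈ S, Real.sqrt (2 * ρ2 (P i).1) :=
          Finset.sum_le_sum fun S _ => hmixed S
      _ = (4 : ℝ) ^ N * ∏ i : Fin N, (1 + Real.sqrt (2 * ρ2 (P i).1)) := by
          rw [← Finset.mul_sum, sum_univ_prod_eq_prod_one_add]
  -- fibres `≤ 2` and the elementary inequality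
  have hfib : ∏ i : Fin N, (1 + Real.sqrt (2 * ρ2 (P i).1)) ≤ ∏ a : Fin m, (1 + Real.sqrt (2 * ρ2 a)) ^ 2 :=
    prod_comp_le_prod_sq (fun i => (P i).1) hP (fun a => 1 + Real.sqrt (2 * ρ2 a)) fun a =>
      le_add_of_nonneg_right (Real.sqrt_nonneg _)
  have hel : ∏ a : Fin m, (1 + Real.sqrt (2 * ρ2 a)) ^ 2 ≤ (4 : ℝ) ^ m * ∏ a : Fin m, (1 + ρ2 a) := by
    calc ∏ a : Fin m, (1 + Real.sqrt (2 * ρ2 a)) ^ 2 ≤ ∏ a : Fin m, (4 * (1 + ρ2 a)) :=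
          Finset.prod_le_prod (fun a _ => sq_nonneg _) fun a _ => one_add_sqrt_two_mul_sq_le (hρ2 a)
      _ = (4 : ℝ) ^ m * ∏ a : Fin m, (1 + ρ2 a) := by
          rw [Finset.prod_mul_distrib, Finset.prod_const, Finset.card_univ, Fintype.card_fin]
  calc ‖W.det‖ ≤ (4 : ℝ) ^ N * ∏ i : Fin N, (1 + Real.sqrt (2 * ρ2 (P i).1)) := hdet
    _ ≤ (4 : ℝ) ^ N * ((4 : ℝ) ^ m * ∏ a : Fin m, (1 + ρ2 a)) := by
        gcongr
        exact hfib.trans hel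
    _ = (4 : ℝ) ^ N * 4 ^ m * ∑ T : Finset (Fin m), ∏ a ∈ T, ∑ b : Fin m, wr (τ b - τ a) := by
        rw [sum_univ_prod_eq_prod_one_add, mul_assoc]

end

end Summit.HubbardSuperconductivity.HubbardSuperconductivity.Theorems.MatsubaraAllU
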